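import Summits.QuantumFields.YangMills.Theorems.ContinuumLimitOnTrajectory.Negative.WitnessRigidity
import Summits.QuantumFields.YangMills.Theorems.ContinuumLimitOnTrajectory.Negative.UltralocalZeroCoupling
import Literature.MathematicalPhysics.QuantumFieldTheory.LatticeGaugeProofs
import HarnessLib

/-!
# `PencilRigidity.NPointIsotropy`, line `complex-rotation-bandlimit`: the lattice one-point factorisation

Stub `latticeOnePointFactor` of crux `stmt-QuantumFields-11686`
(`Summit.QuantumFields.YangMills.Theses.PencilRigidity.NPointIsotropy`), line `complex-rotation-bandlimit`
(lead c1, gen 5), proved over the tree as it is (tree objects `latticeSchwinger`, `smearedLatticeField`,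
`wilsonMeasure`, `torusLift`, `configShift` only; nothing is posited, no named fact is used).

Informal statement. Fix a compact group `G` with a faithful continuous unitary representation `r`, a scaling
scheme `sch` and a step `k`; write `a = a_k`, `c = c_k`, `m = m_k` for the spacing and the renormalisation
constants of the curvature species, `Λ = box 4 L_k` for the fundamental domain of the torus of side `2L_k+1`,
and `μ := ⟨P⟩ = ∫ P(Ũ) dμ_{β_k}(U)` for the Wilson expectation of the action density `P = tr F²` at the origin
(periodic lift `Ũ`). Then for EVERY real Schwartz function `g`
`⟨Φ(g)⟩_k = latticeSchwinger r.ρ sch (·.F) k 1 (fun _ => curvature) (fun _ => g) = c (μ - m) · a⁴ Σ_{y ∈ Λ} g(a y)`: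
the lattice one-point function of the renormalised curvature field factorises through the Riemann sum of `g`,
with a `g`-independent prefactor.

Proof. `Fin.prod_univ_one` removes the one-fold product; the smeared field is
`c a⁴ Σ_y g(a y) (P(τ_y Ũ) - m)`; linearity of the integral (each summand is bounded and measurable, hence
integrable for the probability measure `wilsonMeasure`, `isProbabilityMeasure_wilsonMeasure`) and translation
invariance of the torus Wilson state (`integral_shift_torusLift`: `∫ P(τ_y Ũ) = ∫ P(Ũ) = μ` for every site `y`)
give `c a⁴ Σ_y g(a y) (μ - m)`. References: folklore (translation invariance of the periodic Wilson measure,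
K. Osterwalder, E. Seiler, Ann. Phys. 110 (1978) §2).
-/

noncomputable section

open MeasureTheory Filter Topology
open Literature.MathematicalPhysics.QuantumFieldTheory Literature.MathematicalPhysics.QuantumLattice
open Literature.Probability.LatticeModels (box)
open Summit.QuantumFields.YangMills.Theorems.ContinuumLimitOnTrajectory.Negative

namespace Summit.QuantumFields.YangMills.Theorems.NPointIsotropy.ComplexRotationBandlimit

/-- **One-point expectation of one shifted summand.** Under the torus Wilson state at any coupling `β`, for a
lattice representation `r`, every site `y`, weight `w` and counterterm `m`:
`∫ w · (P(τ_y Ũ) - m) dμ_β(U) = w · (μ - m)` with `μ = ∫ P(Ũ) dμ_β(U)` the (site-independent) expectation of the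
action density — boundedness and measurability of `P` give integrability, translation invariance
(`integral_shift_torusLift`) removes the shift. [folklore] -/
theorem integral_weight_mul_shiftedDensity_sub {G : Type} [Group G] [TopologicalSpace G]
    [IsTopologicalGroup G] [CompactSpace G] [MeasurableSpace G] [BorelSpace G] (r : LatticeRep G) (β : ℝ)
    (S : ℕ) [NeZero S] (y : Literature.Probability.LatticeModels.Site 4) (w m : ℝ) :
    ∫ U, w * (actionDensity r.ρ (configShift (-y) (torusLift S U)) - m)
        ∂wilsonMeasure (d := 4) (L := S) r.ρ β =
      w * ((∫ U, actionDensity r.ρ (torusLift S U) ∂wilsonMeasure (d := 4) (L := S) r.ρ β) - m) := by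
  haveI := isProbabilityMeasure_wilsonMeasure (d := 4) (L := S) r.ρ r.continuous β
  obtain ⟨C, hC⟩ := r.curvature.bounded
  have hmeas : Measurable fun U : GaugeConfig 4 S G => actionDensity r.ρ (configShift (-y) (torusLift S U)) :=
    r.curvature.measurable.comp ((configShift (-y)).measurable.comp (measurable_torusLift _))
  have hint : Integrable (fun U : GaugeConfig 4 S G => actionDensity r.ρ (configShift (-y) (torusLift S U)))
      (wilsonMeasure (d := 4) (L := S) r.ρ β) :=
    Integrable.of_bound hmeas.aestronglyMeasurable C (ae_of_all _ fun U => by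
      rw [Real.norm_eq_abs]; exact hC _)
  rw [integral_const_mul, integral_sub hint (integrable_const _), integral_const, probReal_univ, one_smul,
    integral_shift_torusLift r.ρ β S (actionDensity r.ρ) y]

/-- **Lattice one-point factorisation of the curvature channel.** For every compact group `G`, lattice
representation `r`, scheme `sch` and step `k` there is `μ : ℝ` (the Wilson expectation of the action density at
step `k`, independent of the test function) such that for every real Schwartz `g`
`latticeSchwinger r.ρ sch (·.F) k 1 (fun _ => r.curvature) (fun _ => g) = c_k (μ - m_k) · (a_k⁴ Σ_{y ∈ box 4 L_k} g(a_k y))`.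
Registered helper stub of line `complex-rotation-bandlimit` of crux `stmt-QuantumFields-11686`, stated
byte-for-byte as registered. [folklore] -/
theorem latticeOnePointFactor : ∀ (G : Type) [Group G] [TopologicalSpace G] [IsTopologicalGroup G] [CompactSpace G] [MeasurableSpace G] [BorelSpace G] (r : Literature.MathematicalPhysics.QuantumFieldTheory.LatticeRep G) (sch : Literature.MathematicalPhysics.QuantumFieldTheory.SpeciesScheme (Literature.MathematicalPhysics.QuantumFieldTheory.YMSpecies G)) (k : ℕ), ∃ μ : ℝ, ∀ g : SchwartzMap (EuclideanSpace ℝ (Fin 4)) ℝ, Literature.MathematicalPhysics.QuantumFieldTheory.latticeSchwinger r.ρ sch (fun s => s.F) k 1 (fun _ => r.curvature) (fun _ => g) = sch.c r.curvature k * (μ - sch.m r.curvature k) * (sch.a k ^ 4 * ∑ y ∈ Literature.Probability.LatticeModels.box 4 (sch.L k), g (sch.a k • Literature.MathematicalPhysics.QuantumLattice.siteToE y)) := by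
  intro G _ _ _ _ _ _ r sch k
  refine ⟨∫ U, actionDensity r.ρ (torusLift (sch.side k) U)
    ∂wilsonMeasure (d := 4) (L := sch.side k) r.ρ (sch.β k), fun g => ?_⟩
  haveI := isProbabilityMeasure_wilsonMeasure (d := 4) (L := sch.side k) r.ρ r.continuous (sch.β k)
  unfold latticeSchwinger
  simp only [Fin.prod_univ_one, curvature_F, smearedLatticeField]
  -- integrability of each summand `g(a y) · (P(τ_y Ũ) - m)`
  obtain ⟨C, hC⟩ := r.curvature.bounded
  have hint : ∀ y ∈ box 4 (sch.L k), Integrable (fun U : GaugeConfig 4 (sch.side k) G =>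
      g (sch.a k • siteToE y) *
        (actionDensity r.ρ (configShift (-y) (torusLift (sch.side k) U)) - sch.m r.curvature k))
      (wilsonMeasure (d := 4) (L := sch.side k) r.ρ (sch.β k)) := fun y _ => by
    refine Integrable.const_mul (Integrable.sub ?_ (integrable_const _)) _
    exact Integrable.of_bound
      (r.curvature.measurable.comp ((configShift (-y)).measurable.comp
        (measurable_torusLift _))).aestronglyMeasurable C
      (ae_of_all _ fun U => by rw [Real.norm_eq_abs]; exact hC _)
  rw [integral_const_mul, integral_finsetSum _ hint,
    Finset.sum_congr rfl fun y _ =>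
      integral_weight_mul_shiftedDensity_sub r (sch.β k) (sch.side k) y (g (sch.a k • siteToE y))
        (sch.m r.curvature k),
    ← Finset.sum_mul]
  ring

end Summit.QuantumFields.YangMills.Theorems.NPointIsotropy.ComplexRotationBandlimit

end
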